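import Mathlib
import Summits.MatrixMultiplication.Statement
import Summits.MatrixMultiplication.MatrixMultiplication.Theorems.GraphEquationsExponentDial
import Summits.MatrixMultiplication.MatrixMultiplication.Theorems.GraphEquationsInitialFormsNec
import Summits.MatrixMultiplication.MatrixMultiplication.Theorems.GraphEquationsCoeffIdentity

/-!
# Graph equations — the sub-logarithmic dial and the census split (M25f)

Multiplicity along a SEQUENCE of systems: `EqAdmissibleSeq β mseq` = cost-`O(n^β)` correct systems on
`W_n` whose test ideal contains the `mseq n`-th powers of the graph generators.

* `omega_le_of_eqAdmissibleSeq` — **the dial reaches `o(log n)`**: if `3^{mseq n - 1} = n^{o(1)}`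
  (`SubpolyGrowth`, i.e. multiplicity `o(log n)`) then `EqAdmissibleSeq β mseq → ω ≤ β`
  (unconditional, from `towerSupply`); sub-logarithmic multiplicity is FREE.
* `SublogCompression` (every admissible `β` carries, at every `β' > β`, systems of sub-logarithmic
  multiplicity) is EQUIVALENT to the crux: `multiplicityReduction_iff_sublogCompression`; and the
  crux is equivalent to the log-gap hand: `multiplicityReduction_iff_logGapHand`.
* CENSUS SPLIT at logarithmic multiplicity (`PolyGrowth`: `3^{mseq n - 1} = n^{O(1)}`):
  `LogCompression` (compress to `O(log n)` multiplicity) and `LogDescent` (descend from `O(log n)`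
  multiplicity) are each NECESSARY (`nec_logCompression`, `nec_logDescent`), each implied by the crux,
  jointly give the crux (`multiplicityReduction_of_logCompression_of_logDescent`), and
  `ω = 2 ↔ GraphEquationsQuadratic ∧ LogCompression ∧ LogDescent`; the sub-logarithmic case of
  `LogDescent` is the theorem `subpolyDescent`.
-/

set_option linter.dupNamespace false

noncomputable section

open scoped BigOperators

namespace Summit.MatrixMultiplication.MatrixMultiplication.Theorems.GraphEquations

open MvPolynomial
open Literature.Computability.AlgebraicComplexity

/-- Cost-`O(n^β)` correct systems of membership exponent `≤ mseq n` on `W_n`. -/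
def EqAdmissibleSeq (β : ℝ) (mseq : ℕ → ℕ) : Prop :=
  ∃ c : ℝ, ∀ n : ℕ, 1 ≤ n → ∃ E : EqSystem n, E.Correct ∧
    (∀ q : Fin n × Fin n, generator n q ^ mseq n ∈
      Ideal.span (Set.range fun o : Fin E.tests.length => E.testPoly (E.tests.get o))) ∧
    (E.cost : ℝ) ≤ c * (n : ℝ) ^ β

/-- `3^{mseq n - 1} = n^{o(1)}`: multiplicity `o(log n)`. -/
def SubpolyGrowth (mseq : ℕ → ℕ) : Prop :=
  (∀ n, 1 ≤ mseq n) ∧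
    ∀ ε : ℝ, 0 < ε → ∃ C : ℝ, ∀ n : ℕ, 1 ≤ n → (3 : ℝ) ^ (mseq n - 1) ≤ C * (n : ℝ) ^ ε

/-- `3^{mseq n - 1} = n^{O(1)}`: multiplicity `O(log n)`. -/
def PolyGrowth (mseq : ℕ → ℕ) : Prop :=
  (∀ n, 1 ≤ mseq n) ∧ ∃ C A : ℝ, ∀ n : ℕ, 1 ≤ n → (3 : ℝ) ^ (mseq n - 1) ≤ A * (n : ℝ) ^ C

/-- `o(log n) ⊆ O(log n)`. -/
theorem SubpolyGrowth.polyGrowth {mseq : ℕ → ℕ} (h : SubpolyGrowth mseq) : PolyGrowth mseq := by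
  obtain ⟨C, hC⟩ := h.2 1 one_pos
  exact ⟨h.1, 1, C, hC⟩

/-- Constant multiplicity is sub-logarithmic. -/
theorem subpolyGrowth_const {m : ℕ} (hm : 1 ≤ m) : SubpolyGrowth fun _ => m := by
  refine ⟨fun _ => hm, fun ε _ => ⟨(3 : ℝ) ^ (m - 1), fun n hn => ?_⟩⟩
  have h1 : (1 : ℝ) ≤ (n : ℝ) ^ ε := Real.one_le_rpow (by exact_mod_cast hn) (by positivity)
  calc (3 : ℝ) ^ (m - 1) = (3 : ℝ) ^ (m - 1) * 1 := (mul_one _).symm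
    _ ≤ (3 : ℝ) ^ (m - 1) * (n : ℝ) ^ ε := mul_le_mul_of_nonneg_left h1 (by positivity)

/-- Forgetting the exponents. -/
theorem EqAdmissibleSeq.eqAdmissible {β : ℝ} {mseq : ℕ → ℕ} (h : EqAdmissibleSeq β mseq) :
    EqAdmissible β := by
  obtain ⟨c, hc⟩ := h
  refine ⟨c, fun n hn => ?_⟩
  obtain ⟨E, hE, -, hcost⟩ := hc n hn
  exact ⟨E, hE, hcost⟩

/-- Reduced systems at every `β' > β` give `ω ≤ β`. -/
theorem omega_le_of_redAbove {β : ℝ} (h : ∀ β' : ℝ, β < β' → EqAdmissibleRed β') : omega ℂ ≤ β :=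
  le_of_forall_gt_imp_ge_of_dense fun β' hβ' =>
    omega_le_of_eqAdmissibleInit (eqAdmissibleInit_of_red (h β' hβ'))

/-- `ω ≤ β` gives reduced systems at every `β' > β`. -/
theorem redAbove_of_omega_le {β : ℝ} (h : omega ℂ ≤ β) : ∀ β' : ℝ, β < β' → EqAdmissibleRed β' :=
  fun _ hβ' => eqAdmissibleRed_of_omega_lt (h.trans_lt hβ')

/-- **THE DIAL REACHES `o(log n)`**: sub-logarithmic multiplicity is free —
`SubpolyGrowth mseq → EqAdmissibleSeq β mseq → ω ≤ β`. -/
theorem omega_le_of_eqAdmissibleSeq {β : ℝ} {mseq : ℕ → ℕ} (hg : SubpolyGrowth mseq)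
    (h : EqAdmissibleSeq β mseq) : omega ℂ ≤ β := by
  obtain ⟨c, hc⟩ := h
  refine le_of_forall_gt_imp_ge_of_dense fun β' hβ' => ?_
  obtain ⟨C, hC⟩ := hg.2 (β' - β) (sub_pos.2 hβ')
  have hmem : β' ∈ admissibleExponents ℂ := by
    change (fun n : ℕ => (tensorRank (matMulTensor ℂ n n n) : ℝ)) =O[Filter.atTop]
      fun n : ℕ => (n : ℝ) ^ β'
    refine Asymptotics.IsBigO.of_bound (2 * |C| * |c|) ?_
    filter_upwards [Filter.eventually_ge_atTop 1] with n hn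
    obtain ⟨E, hE, hgen, hcost⟩ := hc n hn
    have h1 := tensorRank_le_towerMultiplier_of_correct hn E hE (hg.1 n) hgen
    rw [Real.norm_of_nonneg (Nat.cast_nonneg _),
      Real.norm_of_nonneg (Real.rpow_nonneg (Nat.cast_nonneg _) _)]
    have h3 : (tensorRank (matMulTensor ℂ n n n) : ℝ) ≤
        2 * (3 : ℝ) ^ (mseq n - 1) * (E.cost : ℝ) := by
      exact_mod_cast h1
    have hnpos : (0 : ℝ) < n := by exact_mod_cast hn
    have hrp0 : (0 : ℝ) ≤ (n : ℝ) ^ (β' - β) := Real.rpow_nonneg hnpos.le _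
    have hrp1 : (0 : ℝ) ≤ (n : ℝ) ^ β := Real.rpow_nonneg hnpos.le _
    have hpow : (3 : ℝ) ^ (mseq n - 1) ≤ |C| * (n : ℝ) ^ (β' - β) :=
      (hC n hn).trans (mul_le_mul_of_nonneg_right (le_abs_self C) hrp0)
    have hcost' : (E.cost : ℝ) ≤ |c| * (n : ℝ) ^ β :=
      hcost.trans (mul_le_mul_of_nonneg_right (le_abs_self c) hrp1)
    have hsplit : (n : ℝ) ^ (β' - β) * (n : ℝ) ^ β = (n : ℝ) ^ β' := by
      rw [← Real.rpow_add hnpos]; ring_nf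
    calc (tensorRank (matMulTensor ℂ n n n) : ℝ)
        ≤ 2 * (3 : ℝ) ^ (mseq n - 1) * (E.cost : ℝ) := h3
      _ ≤ 2 * (|C| * (n : ℝ) ^ (β' - β)) * (|c| * (n : ℝ) ^ β) := by
          gcongr
      _ = 2 * |C| * |c| * (n : ℝ) ^ β' := by rw [← hsplit]; ring
  exact csInf_le (admissibleExponents_bddBelow ℂ) hmem

/-- … hence reduced systems strictly above `β`. -/
theorem eqAdmissibleRed_of_eqAdmissibleSeq {β : ℝ} {mseq : ℕ → ℕ} (hg : SubpolyGrowth mseq)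
    (h : EqAdmissibleSeq β mseq) {β' : ℝ} (hββ' : β < β') : EqAdmissibleRed β' :=
  eqAdmissibleRed_of_omega_lt ((omega_le_of_eqAdmissibleSeq hg h).trans_lt hββ')

/-- **Sub-logarithmic descent is a theorem** (the proved part of `LogDescent`). -/
theorem subpolyDescent (β : ℝ) (mseq : ℕ → ℕ) (hg : SubpolyGrowth mseq) (h : EqAdmissibleSeq β mseq) :
    ∀ β' : ℝ, β < β' → EqAdmissibleRed β' :=
  fun _ hβ' => eqAdmissibleRed_of_eqAdmissibleSeq hg h hβ'

/-- Above `ω`: systems of multiplicity one. -/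
theorem eqAdmissibleSeq_one_of_omega_lt {β : ℝ} (hβ : omega ℂ < β) :
    EqAdmissibleSeq β fun _ => 1 :=
  exists_correct_generator_mem_of_omega_lt hβ

/-! ## The crux ⟺ compression to sub-logarithmic multiplicity ⟺ the log-gap hand -/

/-- `SublogCompression`: every admissible `β` carries, at every `β' > β`, correct systems of
sub-logarithmic multiplicity. -/
def SublogCompression : Prop :=
  ∀ β : ℝ, 2 ≤ β → EqAdmissible β → ∀ β' : ℝ, β < β' →
    ∃ mseq : ℕ → ℕ, SubpolyGrowth mseq ∧ EqAdmissibleSeq β' mseq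

/-- `SublogCompression → MultiplicityReduction`. -/
theorem multiplicityReduction_of_sublogCompression (h : SublogCompression) :
    MultiplicityReduction := by
  intro β hβ hA β' hβ'
  obtain ⟨mseq, hg, hs⟩ := h β hβ hA ((β + β') / 2) (by linarith)
  exact eqAdmissibleRed_of_eqAdmissibleSeq hg hs (by linarith)

/-- `MultiplicityReduction → SublogCompression` (multiplicity one). -/
theorem sublogCompression_of_multiplicityReduction (h : MultiplicityReduction) :
    SublogCompression := by
  intro β hβ hA β' hβ'
  have hω : omega ℂ ≤ β := omega_le_of_redAbove (h β hβ hA)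
  exact ⟨fun _ => 1, subpolyGrowth_const le_rfl, eqAdmissibleSeq_one_of_omega_lt (hω.trans_lt hβ')⟩

/-- **The crux is compression to sub-logarithmic multiplicity.** -/
theorem multiplicityReduction_iff_sublogCompression :
    MultiplicityReduction ↔ SublogCompression :=
  ⟨sublogCompression_of_multiplicityReduction, multiplicityReduction_of_sublogCompression⟩

/-- **The crux is the log-gap hand** (family currency of `GraphEquationsTowerSupply`). -/
theorem multiplicityReduction_iff_logGapHand :
    MultiplicityReduction ↔
      (∀ β : ℝ, 2 ≤ β → EqAdmissible β → ∀ β' : ℝ, β < β' →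
        ∃ c : ℝ, ∀ n : ℕ, 1 ≤ n → ∃ (m N T : ℕ) (t : Fin T → MvPolynomial (GraphVars n) ℂ),
          1 ≤ m ∧ (∀ o, t o ∈ graphIdeal n) ∧
          (∃ gs : List (MvPolynomial (GraphVars n) ℂ), IsNonscalarSeq gs ∧ gs.length ≤ N ∧
            ∀ o, t o ∈ freeSpan {q | q ∈ gs}) ∧
          (∀ q : Fin n × Fin n, generator n q ^ m ∈ Ideal.span (Set.range t)) ∧
          ((2 * 3 ^ (m - 1) : ℕ) : ℝ) * (N : ℝ) ≤ c * (n : ℝ) ^ β') := by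
  refine ⟨fun h β hβ hA β' hβ' => ?_, multiplicityReduction_of_logGapHand⟩
  have hω : omega ℂ ≤ β := omega_le_of_redAbove (h β hβ hA)
  exact exists_growthFamily_of_omega_lt (fun m => 2 * 3 ^ (m - 1)) (hω.trans_lt hβ')

/-! ## Census split at logarithmic multiplicity -/

/-- `LogCompression`: every admissible `β` carries, at every `β' > β`, correct systems of
multiplicity `O(log n)` (`3^{m(n)-1} = n^{O(1)}`). -/
def LogCompression : Prop :=
  ∀ β : ℝ, 2 ≤ β → EqAdmissible β → ∀ β' : ℝ, β < β' →
    ∃ mseq : ℕ → ℕ, PolyGrowth mseq ∧ EqAdmissibleSeq β' mseq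

/-- `LogDescent`: cost-`O(n^β)` systems of multiplicity `O(log n)` give reduced systems above `β`. -/
def LogDescent : Prop :=
  ∀ β : ℝ, 2 ≤ β → ∀ mseq : ℕ → ℕ, PolyGrowth mseq → EqAdmissibleSeq β mseq →
    ∀ β' : ℝ, β < β' → EqAdmissibleRed β'

/-- **The two conjuncts give the crux.** -/
theorem multiplicityReduction_of_logCompression_of_logDescent (hA : LogCompression)
    (hB : LogDescent) : MultiplicityReduction := by
  intro β hβ hAdm β' hβ'
  obtain ⟨mseq, hg, hs⟩ := hA β hβ hAdm ((β + β') / 2) (by linarith)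
  exact hB ((β + β') / 2) (by linarith) mseq hg hs β' (by linarith)

/-- The crux gives `LogCompression` (so `LogCompression` is the weaker statement). -/
theorem logCompression_of_multiplicityReduction (h : MultiplicityReduction) : LogCompression := by
  intro β hβ hA β' hβ'
  obtain ⟨mseq, hg, hs⟩ := sublogCompression_of_multiplicityReduction h β hβ hA β' hβ'
  exact ⟨mseq, hg.polyGrowth, hs⟩

/-- The crux gives `LogDescent` (so `LogDescent` is the weaker statement). -/
theorem logDescent_of_multiplicityReduction (h : MultiplicityReduction) : LogDescent :=
  fun β hβ _ _ hs β' hβ' => h β hβ hs.eqAdmissible β' hβ'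

/-- **NEC**: `ω = 2 → LogCompression`. -/
theorem nec_logCompression (hS : _root_.MatrixMultiplication) : LogCompression :=
  logCompression_of_multiplicityReduction (nec_multiplicityReduction hS)

/-- **NEC**: `ω = 2 → LogDescent`. -/
theorem nec_logDescent (hS : _root_.MatrixMultiplication) : LogDescent :=
  logDescent_of_multiplicityReduction (nec_multiplicityReduction hS)

/-- `SublogCompression → LogCompression`. -/
theorem logCompression_of_sublogCompression (h : SublogCompression) : LogCompression := by
  intro β hβ hA β' hβ'
  obtain ⟨mseq, hg, hs⟩ := h β hβ hA β' hβ'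
  exact ⟨mseq, hg.polyGrowth, hs⟩

/-- **The summit as three conjuncts**: `ω = 2 ↔ GraphEquationsQuadratic ∧ LogCompression ∧ LogDescent`. -/
theorem matrixMultiplication_iff_quadratic_logCompression_logDescent :
    _root_.MatrixMultiplication ↔ GraphEquationsQuadratic ∧ LogCompression ∧ LogDescent :=
  ⟨fun hS => ⟨nec_quadratic hS, nec_logCompression hS, nec_logDescent hS⟩,
    fun h => matrixMultiplication_of_quadratic_of_multiplicityReduction h.1
      (multiplicityReduction_of_logCompression_of_logDescent h.2.1 h.2.2)⟩

end Summit.MatrixMultiplication.MatrixMultiplication.Theorems.GraphEquations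

end
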